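import Literature.MathematicalPhysics.QuantumFieldTheory.ConformalBootstrap3D.BlockExchangeSymmetry
import Literature.MathematicalPhysics.QuantumFieldTheory.ConformalBootstrap3D.BlockReflectedCasimir
import HarnessLib

/-!
# The exchange transform of the typed block solves the exchanged Casimir equation on `(0,½)²`

Assembly of `BlockExchangeSymmetry` (Dolan–Osborn 2011 eq. (2.23) at the level of the operator) and
`BlockReflectedCasimir` (the `z`-series block solves the Casimir equation on the negative square): for every
`Δ` strictly above the 3D unitarity bound, every `(Δ₁₂, Δ₃₄)` and every `(y, ȳ) ∈ (0,½)²` — exactly the points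
whose exchange images `y' = y/(y-1)` lie in `(-1,0)`, inside the `z`-bidisc — the function

  `S = exchTransform (Δ₃₄/2) (hrBlockAB (-Δ₁₂) Δ₃₄ Δ ℓ)`,  `S(y,ȳ) = v^{-Δ₃₄/2} g^{-Δ₁₂,Δ₃₄}_{Δ,ℓ}(y', ȳ')`,

solves the `(Δ₁₂, Δ₃₄)` Casimir equation (`casimirEq3D_exchTransform_hrBlockAB`). By Dolan–Osborn's (2.23)
`S` should be `(-1)^ℓ g^{Δ₁₂,Δ₃₄}_{Δ,ℓ}` there; this identification (series form of `S` on the half-bidisc,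
coefficient extraction on `(0,½)²`, uniqueness) is pub-ising3d RECIPE R20 steps (C')–(E) and is NOT in this
file. The regularity input — first partial derivatives of `hrBlockAB` near, and second partial derivatives at,
a point of the negative square, as generalised power series through `x = -z` — is exported
(`hasDerivAt_hrBlockAB_fst_of_neg` & co.) for that later use.

References: F. A. Dolan, H. Osborn, arXiv:1108.6194, §2 eq. (2.23) [cite: DolanOsborn2011, §2 eq. (2.23)];
F. A. Dolan, H. Osborn, Nucl. Phys. B 678 (2004) 491, §3 eqs. (3.9)–(3.12) [cite: DolanOsborn2004, §3 eqs. (3.9)–(3.12)].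
-/

namespace Literature.MathematicalPhysics.QuantumFieldTheory.ConformalBootstrap3D

open Set Filter Topology

/-! ### The exchange map on `(0,½)` -/

/-- `y ∈ (0,½) ↦ y' = y/(y-1) ∈ (-1,0)`. [folklore] -/
theorem moebiusExch_mem_Ioo_neg {y : ℝ} (hy0 : 0 < y) (hy1 : y < 1 / 2) :
    moebiusExch y ∈ Ioo (-1 : ℝ) 0 := by
  have h1 : y - 1 < 0 := by linarith
  refine ⟨?_, moebiusExch_neg hy0 (by linarith)⟩
  rw [moebiusExch_def, lt_div_iff_of_neg h1]
  linarith

/-! ### Regularity of `hrBlockAB` on the negative square (slices as generalised power series in `x = -z`) -/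

section NegSlices

variable {a b Δ : ℝ} {ℓ : ℕ}

/-- The reflected coefficient families of the two slices. [folklore] -/
theorem geomSummable_reflArr_fst (hΔ : unitarityBound3D ℓ < Δ) {xb : ℝ} (hxb0 : 0 ≤ xb) (hxb1 : xb < 1)
    (u : ℝ) : GeomSummable (fun p : ℕ × ℕ => reflArr (hrMonomialCoeffAB a b Δ ℓ) p * (u * xb ^ p.2)) Prod.fst :=
  (isDoublePowerSeriesOn_reflArr (isDoublePowerSeriesOn_hrSeriesAB (a := a) (b := b) hΔ)).geomSummable_fst
    hxb0 hxb1 u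

/-- The reflected coefficient families of the two slices (second slot). [folklore] -/
theorem geomSummable_reflArr_snd (hΔ : unitarityBound3D ℓ < Δ) {x : ℝ} (hx0 : 0 ≤ x) (hx1 : x < 1)
    (u : ℝ) : GeomSummable (fun p : ℕ × ℕ => reflArr (hrMonomialCoeffAB a b Δ ℓ) p * (u * x ^ p.1)) Prod.snd :=
  (isDoublePowerSeriesOn_reflArr (isDoublePowerSeriesOn_hrSeriesAB (a := a) (b := b) hΔ)).geomSummable_snd
    hx0 hx1 u

/-- On the negative square the block is the reflected generalised power series in `x = -z` (first slot):
`hrBlockAB(z, z̄) = Σ_p k⁻_p x̄^{α+n} x^{α+m}`, `x = -z`, `x̄ = -z̄`. [cite: DolanOsborn2004, §3 eqs. (3.10)–(3.11)] -/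
theorem hrBlockAB_eq_gps_fst_of_neg (Δ₁₂ Δ₃₄ : ℝ) (hΔ : unitarityBound3D ℓ < Δ) {z zb : ℝ}
    (hz : z ∈ Ioo (-1 : ℝ) 0) (hzb : zb ∈ Ioo (-1 : ℝ) 0) :
    hrBlockAB Δ₁₂ Δ₃₄ Δ ℓ z zb =
      gps (fun p : ℕ × ℕ => reflArr (hrMonomialCoeffAB (-Δ₁₂ / 2) (Δ₃₄ / 2) Δ ℓ) p *
          ((-zb) ^ (halfTwist Δ ℓ) * (-zb) ^ p.2)) Prod.fst (halfTwist Δ ℓ) (-z) := by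
  have hx0 : 0 < -z := by linarith [hz.2]
  have hx1 : -z < 1 := by linarith [hz.1]
  have hxb0 : 0 < -zb := by linarith [hzb.2]
  have hxb1 : -zb < 1 := by linarith [hzb.1]
  have hR := isDoublePowerSeriesOn_reflArr
    (isDoublePowerSeriesOn_hrSeriesAB (a := -Δ₁₂ / 2) (b := Δ₃₄ / 2) hΔ)
  have hK : hrSeriesAB (-Δ₁₂ / 2) (Δ₃₄ / 2) Δ ℓ z zb = ∑' p : ℕ × ℕ,
      reflArr (hrMonomialCoeffAB (-Δ₁₂ / 2) (Δ₃₄ / 2) Δ ℓ) p * (-z) ^ p.1 * (-zb) ^ p.2 := by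
    simpa only [neg_neg] using hR.eq_tsum hx0.le hx1 hxb0.le hxb1
  simp only [gps]
  rw [hrBlockAB, show z * zb = (-z) * (-zb) by ring, hK, Real.mul_rpow hx0.le hxb0.le, ← tsum_mul_left]
  refine tsum_congr fun p => ?_
  rw [show (Δ - (ℓ : ℝ)) / 2 = halfTwist Δ ℓ from rfl, Real.rpow_add hx0, Real.rpow_natCast]
  ring

/-- The same through the second slot. [cite: DolanOsborn2004, §3 eqs. (3.10)–(3.11)] -/
theorem hrBlockAB_eq_gps_snd_of_neg (Δ₁₂ Δ₃₄ : ℝ) (hΔ : unitarityBound3D ℓ < Δ) {z zb : ℝ}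
    (hz : z ∈ Ioo (-1 : ℝ) 0) (hzb : zb ∈ Ioo (-1 : ℝ) 0) :
    hrBlockAB Δ₁₂ Δ₃₄ Δ ℓ z zb =
      gps (fun p : ℕ × ℕ => reflArr (hrMonomialCoeffAB (-Δ₁₂ / 2) (Δ₃₄ / 2) Δ ℓ) p *
          ((-z) ^ (halfTwist Δ ℓ) * (-z) ^ p.1)) Prod.snd (halfTwist Δ ℓ) (-zb) := by
  have hx0 : 0 < -z := by linarith [hz.2]
  have hx1 : -z < 1 := by linarith [hz.1]
  have hxb0 : 0 < -zb := by linarith [hzb.2]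
  have hxb1 : -zb < 1 := by linarith [hzb.1]
  have hR := isDoublePowerSeriesOn_reflArr
    (isDoublePowerSeriesOn_hrSeriesAB (a := -Δ₁₂ / 2) (b := Δ₃₄ / 2) hΔ)
  have hK : hrSeriesAB (-Δ₁₂ / 2) (Δ₃₄ / 2) Δ ℓ z zb = ∑' p : ℕ × ℕ,
      reflArr (hrMonomialCoeffAB (-Δ₁₂ / 2) (Δ₃₄ / 2) Δ ℓ) p * (-z) ^ p.1 * (-zb) ^ p.2 := by
    simpa only [neg_neg] using hR.eq_tsum hx0.le hx1 hxb0.le hxb1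
  simp only [gps]
  rw [hrBlockAB, show z * zb = (-z) * (-zb) by ring, hK, Real.mul_rpow hx0.le hxb0.le, ← tsum_mul_left]
  refine tsum_congr fun p => ?_
  rw [show (Δ - (ℓ : ℝ)) / 2 = halfTwist Δ ℓ from rfl, Real.rpow_add hxb0, Real.rpow_natCast]
  ring

/-- **First slice of the block on the negative square is differentiable**, with derivative the reflected
derived series: for `z̄ ∈ (-1,0)` and `z ∈ (-1,0)`,
`∂_z hrBlockAB(z,z̄) = -(Σ_p k⁻_p x̄^{α+n}(m+α) x^{α+m-1})|_{x=-z}`. [cite: DolanOsborn2004, §3 eqs. (3.10)–(3.11)] -/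
theorem hasDerivAt_hrBlockAB_fst_of_neg (Δ₁₂ Δ₃₄ : ℝ) (hΔ : unitarityBound3D ℓ < Δ) {z zb : ℝ}
    (hz : z ∈ Ioo (-1 : ℝ) 0) (hzb : zb ∈ Ioo (-1 : ℝ) 0) :
    HasDerivAt (fun X => hrBlockAB Δ₁₂ Δ₃₄ Δ ℓ X zb)
      (gps (fun p : ℕ × ℕ => reflArr (hrMonomialCoeffAB (-Δ₁₂ / 2) (Δ₃₄ / 2) Δ ℓ) p *
          ((-zb) ^ (halfTwist Δ ℓ) * (-zb) ^ p.2) * ((p.1 : ℝ) + halfTwist Δ ℓ)) Prod.fst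
          (halfTwist Δ ℓ - 1) (-z) * (-1)) z := by
  have hxb0 : 0 < -zb := by linarith [hzb.2]
  have hxb1 : -zb < 1 := by linarith [hzb.1]
  have G1 := geomSummable_reflArr_fst (a := -Δ₁₂ / 2) (b := Δ₃₄ / 2) hΔ hxb0.le hxb1 ((-zb) ^ (halfTwist Δ ℓ))
  have hx : -z ∈ Ioo (0 : ℝ) 1 := ⟨by linarith [hz.2], by linarith [hz.1]⟩
  have hd := (G1.hasDerivAt_gps (halfTwist Δ ℓ) hx).comp z (hasDerivAt_neg' z)
  refine hd.congr_of_eventuallyEq ?_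
  filter_upwards [Ioo_mem_nhds hz.1 hz.2] with X hX
  exact hrBlockAB_eq_gps_fst_of_neg Δ₁₂ Δ₃₄ hΔ hX hzb

/-- **Second derivative data of the first slice**: the derivative function
`X ↦ gps(…)(α-1)(-X)·(-1)` is differentiable at `z`. [cite: DolanOsborn2004, §3 eqs. (3.10)–(3.11)] -/
theorem hasDerivAt_hrBlockAB_fst_deriv_of_neg (Δ₁₂ Δ₃₄ : ℝ) (hΔ : unitarityBound3D ℓ < Δ) {z zb : ℝ}
    (hz : z ∈ Ioo (-1 : ℝ) 0) (hzb : zb ∈ Ioo (-1 : ℝ) 0) :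
    HasDerivAt (fun X => gps (fun p : ℕ × ℕ => reflArr (hrMonomialCoeffAB (-Δ₁₂ / 2) (Δ₃₄ / 2) Δ ℓ) p *
          ((-zb) ^ (halfTwist Δ ℓ) * (-zb) ^ p.2) * ((p.1 : ℝ) + halfTwist Δ ℓ)) Prod.fst
          (halfTwist Δ ℓ - 1) (-X) * (-1))
      (gps (fun p : ℕ × ℕ => reflArr (hrMonomialCoeffAB (-Δ₁₂ / 2) (Δ₃₄ / 2) Δ ℓ) p *
          ((-zb) ^ (halfTwist Δ ℓ) * (-zb) ^ p.2) * ((p.1 : ℝ) + halfTwist Δ ℓ) *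
          ((p.1 : ℝ) + (halfTwist Δ ℓ - 1))) Prod.fst (halfTwist Δ ℓ - 1 - 1) (-z) * (-1) * (-1)) z := by
  have hxb0 : 0 < -zb := by linarith [hzb.2]
  have hxb1 : -zb < 1 := by linarith [hzb.1]
  have G1 := geomSummable_reflArr_fst (a := -Δ₁₂ / 2) (b := Δ₃₄ / 2) hΔ hxb0.le hxb1 ((-zb) ^ (halfTwist Δ ℓ))
  have hx : -z ∈ Ioo (0 : ℝ) 1 := ⟨by linarith [hz.2], by linarith [hz.1]⟩
  exact (((G1.mul_weight (halfTwist Δ ℓ)).hasDerivAt_gps (halfTwist Δ ℓ - 1) hx).comp z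
    (hasDerivAt_neg' z)).mul_const (-1)

/-- First derivative of the second slice on the negative square. [cite: DolanOsborn2004, §3 eqs. (3.10)–(3.11)] -/
theorem hasDerivAt_hrBlockAB_snd_of_neg (Δ₁₂ Δ₃₄ : ℝ) (hΔ : unitarityBound3D ℓ < Δ) {z zb : ℝ}
    (hz : z ∈ Ioo (-1 : ℝ) 0) (hzb : zb ∈ Ioo (-1 : ℝ) 0) :
    HasDerivAt (fun Y => hrBlockAB Δ₁₂ Δ₃₄ Δ ℓ z Y)
      (gps (fun p : ℕ × ℕ => reflArr (hrMonomialCoeffAB (-Δ₁₂ / 2) (Δ₃₄ / 2) Δ ℓ) p *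
          ((-z) ^ (halfTwist Δ ℓ) * (-z) ^ p.1) * ((p.2 : ℝ) + halfTwist Δ ℓ)) Prod.snd
          (halfTwist Δ ℓ - 1) (-zb) * (-1)) zb := by
  have hx0 : 0 < -z := by linarith [hz.2]
  have hx1 : -z < 1 := by linarith [hz.1]
  have G2 := geomSummable_reflArr_snd (a := -Δ₁₂ / 2) (b := Δ₃₄ / 2) hΔ hx0.le hx1 ((-z) ^ (halfTwist Δ ℓ))
  have hxb : -zb ∈ Ioo (0 : ℝ) 1 := ⟨by linarith [hzb.2], by linarith [hzb.1]⟩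
  have hd := (G2.hasDerivAt_gps (halfTwist Δ ℓ) hxb).comp zb (hasDerivAt_neg' zb)
  refine hd.congr_of_eventuallyEq ?_
  filter_upwards [Ioo_mem_nhds hzb.1 hzb.2] with Y hY
  exact hrBlockAB_eq_gps_snd_of_neg Δ₁₂ Δ₃₄ hΔ hz hY

/-- Second derivative data of the second slice. [cite: DolanOsborn2004, §3 eqs. (3.10)–(3.11)] -/
theorem hasDerivAt_hrBlockAB_snd_deriv_of_neg (Δ₁₂ Δ₃₄ : ℝ) (hΔ : unitarityBound3D ℓ < Δ) {z zb : ℝ}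
    (hz : z ∈ Ioo (-1 : ℝ) 0) (hzb : zb ∈ Ioo (-1 : ℝ) 0) :
    HasDerivAt (fun Y => gps (fun p : ℕ × ℕ => reflArr (hrMonomialCoeffAB (-Δ₁₂ / 2) (Δ₃₄ / 2) Δ ℓ) p *
          ((-z) ^ (halfTwist Δ ℓ) * (-z) ^ p.1) * ((p.2 : ℝ) + halfTwist Δ ℓ)) Prod.snd
          (halfTwist Δ ℓ - 1) (-Y) * (-1))
      (gps (fun p : ℕ × ℕ => reflArr (hrMonomialCoeffAB (-Δ₁₂ / 2) (Δ₃₄ / 2) Δ ℓ) p *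
          ((-z) ^ (halfTwist Δ ℓ) * (-z) ^ p.1) * ((p.2 : ℝ) + halfTwist Δ ℓ) *
          ((p.2 : ℝ) + (halfTwist Δ ℓ - 1))) Prod.snd (halfTwist Δ ℓ - 1 - 1) (-zb) * (-1) * (-1)) zb := by
  have hx0 : 0 < -z := by linarith [hz.2]
  have hx1 : -z < 1 := by linarith [hz.1]
  have G2 := geomSummable_reflArr_snd (a := -Δ₁₂ / 2) (b := Δ₃₄ / 2) hΔ hx0.le hx1 ((-z) ^ (halfTwist Δ ℓ))
  have hxb : -zb ∈ Ioo (0 : ℝ) 1 := ⟨by linarith [hzb.2], by linarith [hzb.1]⟩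
  exact (((G2.mul_weight (halfTwist Δ ℓ)).hasDerivAt_gps (halfTwist Δ ℓ - 1) hxb).comp zb
    (hasDerivAt_neg' zb)).mul_const (-1)

end NegSlices

/-! ### The exchange transform of the block solves the exchanged equation -/

/-- **`S = v^{-Δ₃₄/2}·g^{-Δ₁₂,Δ₃₄}_{Δ,ℓ}∘exch` solves the `(Δ₁₂, Δ₃₄)` Casimir equation on `(0,½)²`.**
For `Δ` strictly above the unitarity bound and `y, ȳ ∈ (0,½)`:
`CasimirEq3D Δ₁₂ Δ₃₄ Δ ℓ (exchTransform (Δ₃₄/2) (hrBlockAB (-Δ₁₂) Δ₃₄ Δ ℓ)) y ȳ` — Dolan–Osborn's (2.23)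
covariance (`casimirEq3D_exchTransform_iff`) applied to the negative-square continuation
(`casimirEq3D_hrBlockAB_of_neg`). [cite: DolanOsborn2011, §2 eq. (2.23)] -/
theorem casimirEq3D_exchTransform_hrBlockAB {Δ₁₂ Δ₃₄ Δ : ℝ} {ℓ : ℕ} (hΔ : unitarityBound3D ℓ < Δ)
    {y yb : ℝ} (hy0 : 0 < y) (hy1 : y < 1 / 2) (hyb0 : 0 < yb) (hyb1 : yb < 1 / 2) :
    CasimirEq3D Δ₁₂ Δ₃₄ Δ ℓ (exchTransform (Δ₃₄ / 2) (hrBlockAB (-Δ₁₂) Δ₃₄ Δ ℓ)) y yb := by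
  have hy' := moebiusExch_mem_Ioo_neg hy0 hy1
  have hyb' := moebiusExch_mem_Ioo_neg hyb0 hyb1
  have h₁ : ∀ᶠ X in 𝓝 (moebiusExch y), HasDerivAt (fun X => hrBlockAB (-Δ₁₂) Δ₃₄ Δ ℓ X (moebiusExch yb))
      (gps (fun p : ℕ × ℕ => reflArr (hrMonomialCoeffAB (-(-Δ₁₂) / 2) (Δ₃₄ / 2) Δ ℓ) p *
          ((-moebiusExch yb) ^ (halfTwist Δ ℓ) * (-moebiusExch yb) ^ p.2) * ((p.1 : ℝ) + halfTwist Δ ℓ))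
          Prod.fst (halfTwist Δ ℓ - 1) (-X) * (-1)) X := by
    filter_upwards [Ioo_mem_nhds hy'.1 hy'.2] with X hX
    exact hasDerivAt_hrBlockAB_fst_of_neg (-Δ₁₂) Δ₃₄ hΔ hX hyb'
  have h₂ : ∀ᶠ Y in 𝓝 (moebiusExch yb), HasDerivAt (fun Y => hrBlockAB (-Δ₁₂) Δ₃₄ Δ ℓ (moebiusExch y) Y)
      (gps (fun p : ℕ × ℕ => reflArr (hrMonomialCoeffAB (-(-Δ₁₂) / 2) (Δ₃₄ / 2) Δ ℓ) p *
          ((-moebiusExch y) ^ (halfTwist Δ ℓ) * (-moebiusExch y) ^ p.1) * ((p.2 : ℝ) + halfTwist Δ ℓ))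
          Prod.snd (halfTwist Δ ℓ - 1) (-Y) * (-1)) Y := by
    filter_upwards [Ioo_mem_nhds hyb'.1 hyb'.2] with Y hY
    exact hasDerivAt_hrBlockAB_snd_of_neg (-Δ₁₂) Δ₃₄ hΔ hy' hY
  exact (casimirEq3D_exchTransform_iff Δ₁₂ Δ₃₄ Δ ℓ (by linarith) (by linarith) h₁
    (hasDerivAt_hrBlockAB_fst_deriv_of_neg (-Δ₁₂) Δ₃₄ hΔ hy' hyb') h₂
    (hasDerivAt_hrBlockAB_snd_deriv_of_neg (-Δ₁₂) Δ₃₄ hΔ hy' hyb')).mpr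
    (casimirEq3D_hrBlockAB_of_neg hΔ hy' hyb')

/-- **The `σ–ε` odd pair** (`s = Δ_σ - Δ_ε`): `v^{-s/2}·g_{⟨εσσε⟩}∘exch = exchTransform (s/2) (hrBlockAB (-s) s Δ ℓ)`
solves the `⟨σεσε⟩` (`(s,s)`) Casimir equation on `(0,½)²` — the differential-equation half of
RADIAL-FRAME-DESIGN (F2) on the sub-square where the `z`-series continuation reaches.
[cite: DolanOsborn2011, §2 eq. (2.23)] -/
theorem casimirEq3D_exchTransform_sigmaEps {Δσ Δε Δ : ℝ} {ℓ : ℕ} (hΔ : unitarityBound3D ℓ < Δ)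
    {y yb : ℝ} (hy0 : 0 < y) (hy1 : y < 1 / 2) (hyb0 : 0 < yb) (hyb1 : yb < 1 / 2) :
    CasimirEq3D (Δσ - Δε) (Δσ - Δε) Δ ℓ
      (exchTransform ((Δσ - Δε) / 2) (hrBlockAB (-(Δσ - Δε)) (Δσ - Δε) Δ ℓ)) y yb :=
  casimirEq3D_exchTransform_hrBlockAB hΔ hy0 hy1 hyb0 hyb1

end Literature.MathematicalPhysics.QuantumFieldTheory.ConformalBootstrap3D
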